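import Literature.RepresentationTheory.IntertwiningMapPresentationExtension   -- ★ p853381 row 50 (J): pushout extension, `comp_injective_of_surjective`, `comp_eq_zero_iff_exists_comp_eq`, `finrank_intertwiningMap_presentation`
import HarnessLib

/-!
# Extensions along a length-one presentation, the DEFECT form: `dim Hom_G(C₀, W) ≤ dim Hom_G(V, W) + dim Hom_G(C₁, W)`, with equality only if every extension of `V` by `W` splits —
# so a non-zero Euler–Poincaré defect PRODUCES a non-split extension

Generic representation theory (`k` a field, `G` any monoid); Mathlib `Representation.IntertwiningMap` + ★ row 50 `IntertwiningMapPresentationExtension` (cell `pub/hodgecm-mathlib`, E1 column).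
THEOREMS ONLY (no `def`, no instance, no notation, no named fact, no `sorry`).  Seat «LH6» LH6-p04 (g12), census «12.6.1 (b)-REST VIA THE EP DEFECT + BLOCK SEPARATION» brick (X1).

THE SITUATION (as in ★ row 50): a length-one presentation `0 → C₁ —d→ C₀ —ε→ V → 0` (`d` injective, `ker ε = range d`, `ε` surjective) and a target `W`, all in ONE universe `Type v`.
* §1 `finrank_intertwiningMap_presentation_le` — WITHOUT any splitting hypothesis, `dim Hom_G(C₀, W) ≤ dim Hom_G(V, W) + dim Hom_G(C₁, W)` (rank–nullity for the restriction
  `ψ ↦ ψ ∘ d`, whose kernel is `Hom_G(V, W)` by ★ `comp_eq_zero_iff_exists_comp_eq` ∕ ★ `comp_injective_of_surjective` and whose range sits in `Hom_G(C₁, W)`).  The DEFECT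
  `dim Hom_G(V, W) + dim Hom_G(C₁, W) − dim Hom_G(C₀, W) ≥ 0` is the dimension of the cokernel of the restriction (for `C₀` projective it is `dim Ext¹_G(V, W)`; no projectivity is used here).
* §2 **`exists_nonsplit_extension_of_finrank_ne`** — if `dim Hom_G(C₀, W) ≠ dim Hom_G(V, W) + dim Hom_G(C₁, W)` then SOME extension `0 → W → E → V → 0` (in ★ G2's letters:
  `i` injective, `ker p = range i`, `p` surjective) admits NO section — the contrapositive of ★ row 50 `finrank_intertwiningMap_presentation` (whose hypothesis is «every extension splits»);
  the witness is a pushout `E_φ` of ★ `exists_pushout_extension` along a `G`-map `φ : C₁ → W` that does not extend to `C₀`.  Corollary **`exists_nonsplit_extension_of_finrank_ne_of_subsingleton`**: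
  when `Hom_G(V, W) = 0` (e.g. `V`, `W` non-isomorphic irreducibles), `dim Hom_G(C₀, W) ≠ dim Hom_G(C₁, W)` — a NON-ZERO Euler–Poincaré characteristic `Σ_q (−1)^q dim Hom_G(C_q, W)` — forces a non-split extension.
Consumer: the orthogonality relations [Rogawski1990 Prop. 12.6.1 (b)] read through the Schneider–Stuhler resolution: `⟨χ_π′, χ_π⟩_e = tr π′(f_EP^π) = Σ_q (−1)^q dim Hom_G(C_q^π, π′)`, so a non-zero
elliptic pairing of distinct irreducibles yields a non-split extension of `π` by `π′` (then block separation places both in one principal series).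
HONEST LABEL: count-neutral generic helper; HC_CM is proved only modulo the printed citations until rung 0 closes.

## References
* [Weibel1994] C. Weibel, *An introduction to homological algebra*, CUP 1994, §3.4 Thm. 3.4.3 (extensions and `Ext¹`; the connecting map `Hom(C₁, W) → Ext¹(V, W)`).
* [Fuchs1970] L. Fuchs, *Infinite abelian groups I*, §10 Theorem 10.2 (the pushout).
* [BernsteinZelevinsky1976] I. N. Bernstein, A. V. Zelevinsky, Russian Math. Surveys 31:3 (1976), §2.1–§2.4 (Hom bookkeeping between representations).
-/

set_option autoImplicit false

namespace Literature.RepresentationTheory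

open Representation Function

universe u u' v

section Defect

variable {k : Type u} [Field k] {G : Type u'} [Monoid G]
  {M₁ M₀ X Y : Type v} [AddCommGroup M₁] [Module k M₁] [AddCommGroup M₀] [Module k M₀]
  [AddCommGroup X] [Module k X] [AddCommGroup Y] [Module k Y]
  (ρ₁ : Representation k G M₁) (ρ₀ : Representation k G M₀) (ρV : Representation k G X) (ρW : Representation k G Y)
  (d : IntertwiningMap ρ₁ ρ₀) (ε : IntertwiningMap ρ₀ ρV)

/-! ## §1 The inequality (no splitting hypothesis) -/

/-- **`dim_k Hom_G(C₀, W) ≤ dim_k Hom_G(V, W) + dim_k Hom_G(C₁, W)`** for a pair `C₁ —d→ C₀ —ε→ V` exact at `C₀` with `ε` surjective (`d` need not be injective here), both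
`Hom_G(C₀, W)` and `Hom_G(C₁, W)` finite-dimensional: rank–nullity for the restriction `ψ ↦ ψ ∘ d`, whose kernel is the image of the injection `χ ↦ χ ∘ ε` (★ row 50 §3) and whose range is
a subspace of `Hom_G(C₁, W)`. [cite: Weibel1994, §3.4 Thm. 3.4.3] [cite: BernsteinZelevinsky1976, §2.1–§2.4] -/
theorem finrank_intertwiningMap_presentation_le (hexact : LinearMap.ker ε.toLinearMap = LinearMap.range d.toLinearMap) (hε : Surjective ε)
    [FiniteDimensional k (IntertwiningMap ρ₀ ρW)] [FiniteDimensional k (IntertwiningMap ρ₁ ρW)] :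
    Module.finrank k (IntertwiningMap ρ₀ ρW) ≤ Module.finrank k (IntertwiningMap ρV ρW) + Module.finrank k (IntertwiningMap ρ₁ ρW) := by
  -- the restriction `res : ψ ↦ ψ ∘ d` and the inflation `inf : χ ↦ χ ∘ ε`, `k`-linear
  let res : IntertwiningMap ρ₀ ρW →ₗ[k] IntertwiningMap ρ₁ ρW := (IntertwiningMap.llcomp ρ₁ ρ₀ ρW).flip d
  have hres : ∀ ψ, res ψ = ψ.comp d := fun ψ => rfl
  let inf : IntertwiningMap ρV ρW →ₗ[k] IntertwiningMap ρ₀ ρW := (IntertwiningMap.llcomp ρ₀ ρV ρW).flip ε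
  have hinf : ∀ χ, inf χ = χ.comp ε := fun χ => rfl
  have hinj : Injective inf := comp_injective_of_surjective ρ₀ ρV ρW ε hε
  have hrk : LinearMap.range inf = LinearMap.ker res := by
    ext ψ
    rw [LinearMap.mem_range, LinearMap.mem_ker, hres, comp_eq_zero_iff_exists_comp_eq ρ₁ ρ₀ ρV ρW d ε hexact hε ψ]
    exact ⟨fun ⟨y, hy⟩ => ⟨y, hy⟩, fun ⟨y, hy⟩ => ⟨y, hy⟩⟩
  -- rank–nullity + `dim range(res) ≤ dim Hom(C₁, W)`
  have h := LinearMap.finrank_range_add_finrank_ker res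
  rw [← hrk, LinearMap.finrank_range_of_inj hinj] at h
  have hle : Module.finrank k (LinearMap.range res) ≤ Module.finrank k (IntertwiningMap ρ₁ ρW) := Submodule.finrank_le _
  omega

/-! ## §2 A non-zero defect produces a non-split extension -/

/-- **A NON-ZERO DEFECT FORCES A NON-SPLIT EXTENSION.**  For a length-one presentation `0 → C₁ —d→ C₀ —ε→ V → 0` (`d` injective, `ker ε = range d`, `ε` surjective) and a target `W`
with `Hom_G(C₀, W)` finite-dimensional: if `dim Hom_G(C₀, W) ≠ dim Hom_G(V, W) + dim Hom_G(C₁, W)`, then there is an extension `0 → W —i→ E —p→ V → 0` (`i` injective, `ker p = range i`,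
`p` surjective — ★ G2's letters, `E : Type v`) admitting NO section `s` with `p ∘ s = 1`.  Contrapositive of ★ row 50 `finrank_intertwiningMap_presentation`; the witness is the pushout of
★ `exists_pushout_extension` along a non-extendable `φ : C₁ → W` (Yoneda's connecting map read backwards). [cite: Weibel1994, §3.4 Thm. 3.4.3] [cite: Fuchs1970, §10 Theorem 10.2 (PDF pp. 52–53)] -/
theorem exists_nonsplit_extension_of_finrank_ne (hd : Injective d) (hexact : LinearMap.ker ε.toLinearMap = LinearMap.range d.toLinearMap) (hε : Surjective ε)
    [FiniteDimensional k (IntertwiningMap ρ₀ ρW)]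
    (hne : Module.finrank k (IntertwiningMap ρ₀ ρW) ≠ Module.finrank k (IntertwiningMap ρV ρW) + Module.finrank k (IntertwiningMap ρ₁ ρW)) :
    ∃ (E : Type v) (_ : AddCommGroup E) (_ : Module k E) (ρE : Representation k G E) (i : IntertwiningMap ρW ρE) (p : IntertwiningMap ρE ρV),
      Injective i ∧ LinearMap.ker p.toLinearMap = LinearMap.range i.toLinearMap ∧ Surjective p ∧
        ∀ s : IntertwiningMap ρV ρE, p.comp s ≠ IntertwiningMap.id ρV := by
  by_contra hall
  push Not at hall
  exact hne (finrank_intertwiningMap_presentation ρ₁ ρ₀ ρV ρW d ε hd hexact hε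
    (fun E _ _ ρE i p hi hk hp => hall E inferInstance inferInstance ρE i p hi hk hp))

/-- **Corollary (no homomorphisms)**: if `Hom_G(V, W) = 0` (e.g. `V`, `W` irreducible and non-isomorphic) and the Euler–Poincaré count is non-zero,
`dim Hom_G(C₀, W) ≠ dim Hom_G(C₁, W)`, then some extension of `V` by `W` does not split. [cite: Weibel1994, §3.4 Thm. 3.4.3] [cite: BernsteinZelevinsky1976, §2.1–§2.4] -/
theorem exists_nonsplit_extension_of_finrank_ne_of_subsingleton (hd : Injective d) (hexact : LinearMap.ker ε.toLinearMap = LinearMap.range d.toLinearMap) (hε : Surjective ε)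
    [FiniteDimensional k (IntertwiningMap ρ₀ ρW)] [Subsingleton (IntertwiningMap ρV ρW)]
    (hne : Module.finrank k (IntertwiningMap ρ₀ ρW) ≠ Module.finrank k (IntertwiningMap ρ₁ ρW)) :
    ∃ (E : Type v) (_ : AddCommGroup E) (_ : Module k E) (ρE : Representation k G E) (i : IntertwiningMap ρW ρE) (p : IntertwiningMap ρE ρV),
      Injective i ∧ LinearMap.ker p.toLinearMap = LinearMap.range i.toLinearMap ∧ Surjective p ∧
        ∀ s : IntertwiningMap ρV ρE, p.comp s ≠ IntertwiningMap.id ρV := by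
  refine exists_nonsplit_extension_of_finrank_ne ρ₁ ρ₀ ρV ρW d ε hd hexact hε ?_
  rwa [show Module.finrank k (IntertwiningMap ρV ρW) = 0 from Module.finrank_zero_of_subsingleton, zero_add]

end Defect

end Literature.RepresentationTheory
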